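import Literature.MathematicalPhysics.QuantumFieldTheory.Balaban1983to89.T4TermFormat
import Literature.MathematicalPhysics.QuantumFieldTheory.Balaban1983to89.T4DressedR
import Literature.MathematicalPhysics.QuantumFieldTheory.Balaban1983to89.T4GatedBooking

/-!
# T4 — PRESERVATION of the term format under a LATER ℝ-step (T4-DAG v3 §5 row T4-O3.E-iii-c): hypothesis shapes
over `T4TermFormat.Booking`, the kernel bookkeeping "sizes multiply, budgets add", and the real-fibre sandwich for a
dressing that carries old D-terms — NO estimate of Bałaban's expansions

Cell `pub-balaban` (audit/reconstruction of T. Bałaban's lattice Yang–Mills series 1983–89; host summit YangMills; NOT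
summit work: rung (B)+1 of the cell's ladder only — NOT infinite volume, NOT a mass gap, NOT the Clay problem; the value
of this file is a typed skeleton with located obligations, not summit progress).

CITATION HEADER (lean-in-tree rule 2026-08-18).  B16 = T. Bałaban, *Large field renormalization. II. Localization,
exponentiation, and bounds for the 𝐑 operation*, Comm. Math. Phys. **122**, 355–392 (1989) [Balaban1989LargeFieldII]
(PDF held `paper:balaban1989-cmp122-large-field-ii`, journal page = PDF page + 354); B15 = T. Bałaban, *Large field
renormalization. I. The basic step of the 𝐑 operation*, Comm. Math. Phys. **122**, 175–202 (1989) [Balaban1989LargeFieldI]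
(journal page = PDF page + 174).  Both papers are manuscripts UNDER ADJUDICATION by the cell; nothing of them is asserted
here.  Quotations `[R pNNN]` were checked against the page renders `b2b-balaban-ref1/pages/1989-cmp122-large-field-II/
1989-cmp122-large-field-II-pNNN-x2.png` (B15: `…large-field-I-p027-x2.png`), read as images, not OCR; they agree with the
lineage census `t4/T4-XREAD-O3X2.md` §1 (loci Q375a–Q391b).

ROW TEXT (T4-DAG v3 §5, verbatim): "(v3) PRESERVATION UNDER A LATER ℝ-STEP (dressed again): a D-term born at (j, Λ_i)
whose block-tower branch meets a LATER large-field component Λ′ at scale k > j is integrated by ℝ′ at k together with the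
boundary terms it multiplies (B16 (1.68)/(1.69) factor-format pair; cost e^{3sup∣D∣} by (1.75) — X2 (L2)/(L3)); show that
the class of -iii-a is reproduced (new D-terms born at (k, Λ′) absorb the old ones' Λ′-dependence; sizes multiply,
budgets add) and that X2's obligation (B) does not re-appear (localisation domains stay ordinary); `Prop`
`PreservedUnderR` + EST record keyed to the B16 loci of X2's 17-row census".  Companion EST record (markdown, cell HOME):
`t4/T4-EST-O3Eiiic.md`.

HONEST FRAMING.  HYPOTHESIS SHAPES, NOT PRINTED, NOT ASSERTED.  Nothing in this file is a statement of B15/B16 and nothing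
is asserted about Bałaban's expansions or about the cell's D-terms: §2 fixes, over the abstract index data `Booking` of
row O3.E-iii-a (`T4TermFormat`, p180102), the DATA of one later ℝ-step (pre-step sizes, which new birth absorbs which old
births, the cubes of the renormalised component, the dressing's own size) and PREDICATES saying what "the class is
reproduced" means quantitatively — CONTINUATION of old births at a per-step cost factor (sizes multiply), ADDITIVE
absorption at new births (budgets add), FELT-HOME (new births are felt, at their birth scale, only on component cubes or
where an absorbed birth was felt: the counting shadow of "localisation domains stay ordinary", i.e. X2's obligation (B)
— a tube-relative inductive class with no large-field home — does not re-appear); §3 is kernel bookkeeping [folklore]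
(finite sums, one induction through `Booking.sizeBound_of_step`) turning these shapes into the currencies of row
O3.E-iii-a (`SizeBound`, `CubeBudget`, positional counts) and exhibiting honestly where the ℝ-cost is paid (the per-step
factor `α` enters the size array as `α^{k−j}`, i.e. as the gain `φ := α` of `Booking.cubeBudget_of_twoRate`, so the budget
closes only under `Λ·α·τ ≤ 1`); §1 is the measure-theoretic kernel fact behind "budgets add" at the level of B15's real
normalised operation (convention (α) of `T4DressedR`): a dressing `exp(t·F + D)` with `|F| ≤ B` and `|D| ≤ S` — `D` the
sum of the old D-terms riding in the same fibre — is sandwiched with exponent budget `|t|B + S`.  Whether Bałaban's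
(1.65)–(1.75) mechanism realises the §2 shapes for the cell's D-terms, with which cost factors, is the EST question of the
row and is RECORDED (with located obligations) in `t4/T4-EST-O3Eiiic.md`, not decided here.  ABSOLUTE RULE honoured: no
internally minted statement is cited as a fact; the printed context below is quoted for context only.

PRINTED CONTEXT (verbatim, B16 unless marked; [R pNNN] as above).
* p. 375 [R p021], (1.65): *"the extended function U⁰_k described above is an analytic function of the variables (U,J)
  in the space Ũ^c_k(Y₄,α̃₀,α̃₁), with values in the space Ũ″^c_k(Y₁,α̃₀,α̃₁), i.e., (U,J)∈Ũ^c_k(Y₄,α̃₀,α̃₁) →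
  U⁰_k(U,J)∈Ũ″^c_k(Y₁,α̃₀,α̃₁). (1.65)"* … *"In particular, the space Ũ″^c_k(Y₁,α̃₀,α̃₁) is contained in the analyticity
  domain of the term E(X) we consider, hence in the analyticity domains of all terms in the obtained effective action. …
  This implies the basic fact that the function E(X,U⁰_k) is an analytic function of the variables (U,J) on the space
  Ũ^c_k(Y₄,α̃₀,α̃₁)."* (the FROZEN/continued part of an old term: composition with the extension map.)
* p. 377 [R p023], (1.68)/(1.69): *"|V(Y,(U,J))| ≤ α exp(−(1+2β)κd_{k,Z}(Y)) (1.68) for Y∖Z^~ ≠ ∅, with a constant α,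
  which can be chosen arbitrarily small for γ small enough, and |V(Y,(U,J))| ≤ O(1)Σ_{j=1}^{k}|Γ⁰_j∩Y|, (1.69) if Y is
  a component of Z^~."* (the factor-format pair named by the row; (1.69) is ADDITIVE over the history and decay-free.)
* p. 379 [R p025], after (1.72): *"Notice that the terms V(Y,U_k) depend on the sequence {Ω^c_j,Z_j} restricted to the
  components of Z contained in Y, and that the sum in the definition (1.71) acts also on the last exponential in (1.72).
  The sum in the last exponential does not include terms with localization domains equal to one of the components of
  Z^~; these terms are included into the operations T′_k."* (old terms meeting the component ride INSIDE T′_k(X).)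
* p. 380 [R p026], (1.73)–(1.75): *"|T′_k(X,(U,J))F| = |T′_k(X,(U,0))e^σF| ≤ T′_k(X,(U,0))|e^σF| ≤ (T′_k(X,(U,0))1) sup
  e^{|σ|}|F|, (1.73) |T′_k(X,(U,J))1| = |T′_k(X,(U,0))e^σ| ≥ T′_k(X,(U,0))e^{−2|σ|} ≥ (T′_k(X,(U,0))1)e^{−2 sup|σ|},
  (1.74) where σ is the small term of the first order in A′, J, and F is a function of the integration variables in the
  integral (1.71). … |(T′_k(X,(U,J))1)^{−1}T′_k(X,(U,J))F| ≤ e^{3 sup|σ|} sup|F|. (1.75)"* (the COST locus: a normalised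
  T′-expectation of a bounded F costs the factor e^{3 sup|σ|} — "sizes multiply".)
* p. 388 [R p034], after (1.92): *"where Z′ = ⋃_{i=1}^{m}Y_i ∪ ⋃_{h=1}^{q}X_{j_h}, and we have estimated the expression |σ|
  in (1.73) by 1."*; p. 391 [R p037]: *"the first product over h is replaced by the product of e³ over indices i such
  that Y_i ⊂ X′"* (the printed value of the cost factor: e³ per renormalised component.)
* p. 391 [R p037]: *"using the fact that the T′_k-operations are normalized, i.e., if such an operation is applied to a
  function which does not depend on the integration variables connected with the operation, then it is equal to 1."*
  (SPECTATOR: an old term not meeting the component is untouched — cost factor 1; kernel twin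
  `T4DressedR.ropRealIn_eq_mul_of_fibreIndep`) and *"in this bound there are no tree decay exponential factors for the
  domains Y_i. In fact, looking carefully at a standard proof of the convergence of the expansion (e.g., in [26]), we see
  that in the present situation such factors are not needed, because there are no summations over these domains, they
  are fixed."* (the FIXED-DOMAIN exemption: terms homed at a large-field component need no tree decay.)
* B15 p. 201 [R I-p027], (1.102): *"The above operation has the fundamental normalization property ∫dV_k(ℝ′ρ_k)(V_k) =
  ∫dV_kρ_k(V_k). (1.102)"* (kernel-checked with a dressing inside the integrated factor: `T4DressedR.integral_ropRealIn_eq`.)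

WHAT IS TYPED.  §1 (over `Setup`, real densities): `exp_dressing_bounds_add`, `abs_sum_dterms_le` (|Σ_i D_i| ≤ Σ_i S_i:
budgets add), `ropRealIn_exp_add_sandwich` (e^{−(|t|B+S)}·ℝ(ρ) ≤ ℝ_in(ρ·e^{tF+D}) ≤ e^{|t|B+S}·ℝ(ρ), from
`T4DressedR.mul_le_ropRealIn` / `ropRealIn_le_mul`), `exp_budget_mul` (e^{|t|B+S} = e^{|t|B}·e^{S}: sizes multiply).
§2 `RStep B` (data of one later ℝ-step over a `Booking`) and the shapes `Continues a`, `Absorbs A`, `FeltHome`,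
`PreservedUnderR a A` (= the row's `Prop`: their conjunction), with the auxiliary currencies `preload`, `PreBudget`,
`PreBudgetW`, `CompVol`, `DeltaBudget`, `NewCount`, `CompCount`, `FanIn`, `TShape` (row O3.E-iii-b's one-T-step shape,
delivering the pre-ℝ sizes), `TNonexpansive`.  §3 bookkeeping: `absorbed_le` (the absorbed pre-mass of a new birth is at
most the old pre-load summed over the component's cubes), `birth_le_of_budget` (new birth ≤ δ + A·v·c: the absorbed
mass RE-CONCENTRATES — a new birth collects the pre-loads of all `v` cubes of its component), `load_le_preload`,
`newLoad_le`, **`cubeBudget_after`** (post-step `CubeBudget w (ā·c_w + Δ + ν·A·v·c)`: budgets add), `sizeBound_of_TR`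
(T-shape ∘ ℝ-continuation feed `Booking.sizeBound_of_step`), **`sizeBound_geometric`** / `sizeBound_twoRate` (a uniform
per-step cost `a k ≤ α` turns a birth bound `S j ≤ A₀τ^{K−j}` into `SizeBound (fun j k => A₀·α^{k−j}·τ^{K−j})` — exactly
the `hσle` input of `Booking.cubeBudget_of_twoRate` with gain `φ := α`: sizes multiply along the history and the budget
then needs `Λ·α·τ ≤ 1`), `newCount_of_feltHome` (FELT-HOME + component count + absorption fan-in + old positional count
bound the new positional count: no tube-relative positions arise), `feltHome_of_anchor` (v1.1: FELT-HOME from block data —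
a birth felt at a cube of its own scale has the cube's block in its domain, e.g. `T4FeltGeometry.Anchoring.felt_under` at
scale difference 0 — when the component cubes contain every such cube: the netted booking anchors a new birth at its
component alone).  §4 the empty ℝ-step over `Booking.vacuum K` meets `PreservedUnderR` (non-vacuity of the shapes,
nothing more).  §5 (v1.1) THE NETTED BOOKING ON A REAL FIBRE [folklore]: for a probability measure `μ` (standing for the
normalised POSITIVE operation of one ℝ-step restricted to a real fibre) and a measurable exponent `Φ` with `sup|Φ| ≤ s ≤ 1`:
`E[Φ] ≤ log E[e^Φ] ≤ E[Φ] + s²` (`integral_le_log_integral_exp`, Jensen; `log_integral_exp_le`, from |e^x − 1 − x| ≤ x²),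
`|E[D]| ≤ sup|D|` (`abs_integral_le_of_abs_le`: a continuation `E[D_b]` has size ≤ pre-size, `Continues` with `a = 1`),
and **`netted_birth_le`**: with `Φ = ω + Σ_i Δ_i`, `|ω| ≤ s_ω`, `|Δ_i| ≤ S_i`, `s_ω + Σ S_i ≤ 1`, the birth `log E[e^Φ]`
minus the RETURNED first cumulants `Σ_i E[Δ_i]` is at most `s_ω + (s_ω + Σ S_i)²` — first-order budgets add and are
re-attributed to the continuations, only second-order mass is born; `netted_absorbs_shape` reads this as `Absorbs` with
`δ = (1+s)·s_ω` and SMALL absorption constant `A = s` (located obligation (R-conc) of the EST record, real-fibre half).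
§3b (v1.2) THE GATED SEAM with `T4GatedBooking` (p180311; advisory A1 of the cross-read C-pv12g5-7 and pv18-g4's
NOTE 22:34:29Z): `RStep.TShapeGated σ π Gate` (the T-step output bound `pre b (k+1) ≤ π j (k+1)` holds only under the
scale-`k` gate, e.g. `Gate k = CubeBudgetAt B w c k ∧ H k` — the (TOB-k) circularity of T4-REF-O3 V4), `tShapeGated_of_tShape`,
**`gatedStep_of_TR`** (gated T-shape + `Continues a` + `a (k+1)·π j (k+1) ≤ σ j (k+1)` ⇒ `T4GatedBooking.GatedStep B σ Gate`:
a later ℝ-step composes INSIDE one gated step, no second step hypothesis per scale) and `sizeBound_cubeBudget_of_TR_gated`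
(= `T4GatedBooking.sizeBound_cubeBudget_of_gatedStep` fed by it: `SizeBound σ ∧ CubeBudget w c ∧ ∀ k ≤ K, H k`).
§6 (v1.2) DISCRETE GRÖNWALL [folklore, pure Mathlib]: `discreteGronwall` (`c (k+1) ≤ (1 + ε k)·c k + Δ k`, `ε, Δ ≥ 0`,
`c 0 ≥ 0` ⇒ `c n ≤ exp(Σ_{k<n} ε k)·(c 0 + Σ_{k<n} Δ k)`) and `discreteGronwall_uniform` (`Σ ε ≤ E`, `Σ Δ ≤ D` uniformly ⇒
`c n ≤ e^E·(c 0 + D)` for all `n`) — the K-UNIFORMITY SHAPE of the per-cube budget constant iterated along the later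
ℝ-steps with the NETTED absorption constant `ε k = ν·v·s_k` (`s_k = sup|Φ_k|`, §5) and the dressings' own sizes `Δ k`:
K-uniform iff `Σ_k s_k` and `Σ_k Δ_k` are K-uniformly bounded (located obligation (iii) of GAPS C-b02g7-2, cell-side).
§7 (v1.3) THE NETTED BOOKING ON A COMPLEX FIBRE [folklore, pure Mathlib] — the abstraction of B16 (1.73)–(1.75) p. 380:
the base operation `T′_k(X,(U,0))` is POSITIVE and normalised (↦ a probability measure `μ`), the complex dependence sits in
the exponent `σ` (↦ a measurable `Φ : Ω → ℂ` with `‖Φ‖ ≤ s`): `norm_integral_cexp_sub_one_sub_le` (`‖E[e^Φ] − 1 − E[Φ]‖ ≤ s²`,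
`s ≤ 1`), **`norm_log_integral_cexp_sub_le`** (`‖log E[e^Φ] − E[Φ]‖ ≤ 3s²`, `s ≤ 1/4`, principal log in the disc
`‖E[e^Φ] − 1‖ ≤ 5/16`), `exp_neg_two_mul_le_norm_integral_cexp` (`e^{−2s} ≤ ‖E[e^Φ]‖`: the constant 2 of (1.74)),
`norm_integral_cexp_mul_le` (`‖E[e^Φ F]‖ ≤ e^{3s}·sup‖F‖·‖E[e^Φ]‖`: the constant 3 of (1.75) — `Continues` with
`a = e^{3s}` on a complex fibre) and **`netted_birth_le_complex`** (`Φ = ω + Σ_i Δ_i`, `s_ω + Σ S_i ≤ 1/4` ⇒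
`‖log E[e^Φ] − Σ_i E[Δ_i]‖ ≤ s_ω + 3(s_ω + Σ S_i)²`: budgets add and are re-attributed, the complex netted absorption
constant is `3·sup‖Φ‖` — still SMALL).  (For finite positive functionals the pointwise (1.73)–(1.75) are `B16.ineq173`–`ineq175`,
not imported here.)

NOT TYPED / NOT CLAIMED: that the cell's dressed D-terms satisfy any of the shapes; the construction of §5's probability
measure from `T4DressedR.RopReal` (an abstraction: B15 p. 176 «the denominators are positive» makes the undressed real
operation a probability on each fibre, but that identification is not typed here) and, beyond §7's abstraction (positive normalised base
operation, complex exponent with `sup‖Φ‖ ≤ 1/4` on the complex domain — the smallness IS located obligation (R-small)), any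
version with a non-positive base weight; the values of `a`, `A`, `δ`, `v`, `ν`
(all abstract; the EST record locates them: a k = e^{3 sup|σ_k + ω_X + ΣΔD|} per (1.75) with the printed estimate e³,
v ≤ #M-cubes of a component of Z^~_k with collars, δ from rows O3b.K / O3.E-i′); complex (U,J)-domains and the lower bound
(1.74) there (located obligation (R-small): sup|σ + ω + ΣΔD| ≤ 1 per component, a μ-radius condition for row O4);
the extension property (1.65) for the D-terms' tower carriers (obligation (R-ext)); the T-step (row O3.E-iii-b); the pair
class across components through one dressing (row O3.E-ii, `T4JointDressing`); any geometry beyond the counting shadows.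
Interfaces consumed BY NAME, not restated: `T4TermFormat.Booking` and its `load`/`CubeBudget`/`SizeBound`/
`sizeBound_of_step`/`cubeBudget_of_twoRate` (p180102 v1.1); `T4DressedR.RopRealIn`/`RopReal`/`mul_le_ropRealIn`/
`ropRealIn_le_mul` (p178563); `T4GatedBooking.GatedStep`/`BirthBound`/`GateOfSizes`/`CubeBudgetAt`/
`sizeBound_cubeBudget_of_gatedStep` (p180311, v1.2) and `T4TubeBudget.TubeBudget`; Mathlib `ConvexOn.map_integral_le` (Jensen), `Real.abs_exp_sub_one_sub_id_le`,
`Real.log_le_sub_one_of_pos`, `MeasureTheory.norm_integral_le_of_norm_le_const`, `Complex.norm_exp_sub_one_sub_id_le`,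
`Complex.norm_log_one_add_sub_self_le` (v1.3).

Versions: v1 = p180232 (2026-08-18, commit 7f6f2a1ffd0d): §1–§4.  v1.1 = p180360 (commit a80ae5088e60): + `RStep.feltHome_of_anchor`,
+ §5 (netted booking on a real fibre).  v1.2 (this file): + import `T4GatedBooking`, + §3b (gated seam: `TShapeGated`,
`tShapeGated_of_tShape`, `gatedStep_of_TR`, `sizeBound_cubeBudget_of_TR_gated`), + §6 (discrete Grönwall) = p180407 (commit
ef428ef5b8ef).  v1.3 (this file): + §7 (netted booking on a complex fibre: the (1.74)/(1.75) constants 2 and 3 in the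
abstraction, `netted_birth_le_complex`); additive — no v1/v1.1/v1.2 declaration changed.
-/

open scoped BigOperators
open Finset

namespace Literature.MathematicalPhysics.QuantumFieldTheory.Balaban1983to89.T4PreservedUnderR

/-! ## §1 The real-fibre kernel of "budgets add": a dressing carrying the old D-terms -/

section Kernel

open B15.BasicStep T4DressedR

variable {P : Params} {j : ℕ} {G : Type*} [GaugeGroup G] [MeasurableSpace G] [HaarData G]
variable [DecidableEq (PBond P j)]

omit [GaugeGroup G] [MeasurableSpace G] [HaarData G] [DecidableEq (PBond P j)] in
/-- Pointwise bounds for the dressing `exp(t·F + D)` with `|F| ≤ B` (the source term) and `|D| ≤ S` (the old D-terms riding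
in the same fibre): `e^{−(|t|B+S)} ≤ e^{tF+D} ≤ e^{|t|B+S}` — the exponent budgets ADD. [folklore] -/
theorem exp_dressing_bounds_add {F D : Density P j G} {B S : ℝ} (hF : ∀ V, |F V| ≤ B) (hD : ∀ V, |D V| ≤ S)
    (t : ℝ) (V : GaugeField P j G) :
    Real.exp (-(|t| * B + S)) ≤ Real.exp (t * F V + D V) ∧ Real.exp (t * F V + D V) ≤ Real.exp (|t| * B + S) := by
  have h1 : |t * F V| ≤ |t| * B := by
    rw [abs_mul]
    exact mul_le_mul_of_nonneg_left (hF V) (abs_nonneg t)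
  have h2 := hD V
  constructor
  · exact Real.exp_le_exp.mpr (by linarith [neg_abs_le (t * F V), neg_abs_le (D V)])
  · exact Real.exp_le_exp.mpr (by linarith [le_abs_self (t * F V), le_abs_self (D V)])

omit [GaugeGroup G] [MeasurableSpace G] [HaarData G] [DecidableEq (PBond P j)] in
/-- The sum of finitely many old D-terms with sizes `S i` has size at most `Σ S i` ("budgets add"). [folklore] -/
theorem abs_sum_dterms_le {ι' : Type*} (s : Finset ι') (D : ι' → Density P j G) (S : ι' → ℝ)
    (hD : ∀ i ∈ s, ∀ V, |D i V| ≤ S i) (V : GaugeField P j G) :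
    |∑ i ∈ s, D i V| ≤ ∑ i ∈ s, S i :=
  (Finset.abs_sum_le_sum_abs _ _).trans (Finset.sum_le_sum fun i hi => hD i hi V)

/-- "Sizes multiply": the sandwich constant of the combined dressing is the product of the constants. [folklore] -/
theorem exp_budget_mul (t B S : ℝ) : Real.exp (|t| * B + S) = Real.exp (|t| * B) * Real.exp S :=
  Real.exp_add _ _

/-- SANDWICH for a dressing carrying old D-terms (convention (α) of `T4DressedR`, real densities over `Setup`): for
nonnegative bounded measurable pieces, `e^{−(|t|B+S)}·ℝ(ρ)(V) ≤ ℝ_in(ρ·e^{tF+D})(V) ≤ e^{|t|B+S}·ℝ(ρ)(V)` — the old terms'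
budget `S` ADDS to the source budget `|t|B` in the exponent; the measure-theoretic skeleton only (no analyticity, no
complex (U,J), no locality). [folklore] -/
theorem ropRealIn_exp_add_sandwich {R : Type*} [Fintype R] (piece : R → Density P j G) (pp : R → R)
    (fib : R → Finset (PBond P j)) {F D : Density P j G} {B S : ℝ} (hF : ∀ V, |F V| ≤ B) (hD : ∀ V, |D V| ≤ S)
    (t : ℝ) (hm : ∀ Z, Measurable (piece Z)) (h0 : ∀ Z V, 0 ≤ piece Z V) {C : ℝ} (hC : ∀ Z V, piece Z V ≤ C)
    (V : GaugeField P j G) :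
    Real.exp (-(|t| * B + S)) * RopReal piece pp fib V
        ≤ RopRealIn piece pp fib (fun U => Real.exp (t * F U + D U)) V ∧
      RopRealIn piece pp fib (fun U => Real.exp (t * F U + D U)) V
        ≤ Real.exp (|t| * B + S) * RopReal piece pp fib V := by
  have hlo : ∀ U, Real.exp (-(|t| * B + S)) ≤ Real.exp (t * F U + D U) := fun U =>
    (exp_dressing_bounds_add hF hD t U).1
  have hhi : ∀ U, Real.exp (t * F U + D U) ≤ Real.exp (|t| * B + S) := fun U =>
    (exp_dressing_bounds_add hF hD t U).2
  constructor
  · exact mul_le_ropRealIn piece pp fib (fun U => Real.exp (t * F U + D U)) (fun _ => Real.exp (-(|t| * B + S)))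
      (fun _ => Real.exp (|t| * B + S)) hm h0 hC (fun _ _ _ => rfl) (fun _ => (Real.exp_pos _).le) hlo
      (fun _ _ _ => rfl) hhi V
  · exact ropRealIn_le_mul piece pp fib (fun U => Real.exp (t * F U + D U)) (fun _ => Real.exp (|t| * B + S)) hm h0 hC
      (fun _ => (Real.exp_pos _).le) (fun _ _ _ => rfl) hhi V

end Kernel

/-! ## §2 One later ℝ-step over a `Booking`: data and hypothesis shapes -/

open T4TermFormat

/-- HYPOTHESIS SHAPE — NEW COUNT (a `Booking`-level currency): at most `ν` births of the scale of `q` are felt at `q`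
(the diagonal of `Booking.PositionalCount`, see `RStep.newCount_of_positionalCount`). [folklore] -/
def NewCount (B : Booking) (ν : ℝ) : Prop :=
  ∀ q : B.Cube, ((B.feltOfScale q (B.cubeScale q)).card : ℝ) ≤ ν

/-- DATA of one later ℝ-step over the index data `B : Booking` of row O3.E-iii-a (cell analysis, T4-DAG v3 node O3b /
T4-REF-O3 V4; NOT PRINTED): `pre b k` = the booked size of the term born at `b` just BEFORE the ℝ-operation of scale `k`
(the output of the T-step `k−1 → k`, row O3.E-iii-b; meaningful for `birthScale b < k ≤ K`); `absorbs b′` = the old births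
whose dependence on the component renormalised at the new birth `b′` is absorbed by `b′` (their scale-`k` branch meets that
component), all born strictly earlier; `comp b′` = the cubes (of the birth scale of `b′`) of that component with its collars;
`absorbs_felt`: an absorbed birth was felt at some cube of the component; `δ b′` = the dressing's own size at the new birth
(rows O3b.K / O3.E-i′ supply it).  No geometry beyond these counting shadows. [folklore] -/
structure RStep (B : Booking) where
  /-- size just before the ℝ-operation of scale `k` -/
  pre : B.Birth → ℕ → ℝ
  pre_nonneg : ∀ b k, 0 ≤ pre b k
  /-- the old births absorbed by a new birth -/
  absorbs : B.Birth → Finset B.Birth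
  absorbs_lt : ∀ b' b, b ∈ absorbs b' → B.birthScale b < B.birthScale b'
  /-- the cubes of the renormalised component (with collars) at a birth, of the birth scale -/
  comp : B.Birth → Finset B.Cube
  comp_scale : ∀ b' q, q ∈ comp b' → B.cubeScale q = B.birthScale b'
  absorbs_felt : ∀ b' b, b ∈ absorbs b' → ∃ q ∈ comp b', b ∈ B.feltAt q
  /-- the dressing's own size at a birth -/
  δ : B.Birth → ℝ
  δ_nonneg : ∀ b', 0 ≤ δ b'

namespace RStep

variable {B : Booking} (R : RStep B)

/-- HYPOTHESIS SHAPE — CONTINUATION ("sizes multiply"): after the ℝ-operation of scale `k` every older term is booked at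
cost factor `a k` times its pre-step size: `size b k ≤ a k · pre b k` for `birthScale b < k ≤ K`.  Instances the EST record
discusses: `a k = 1` for spectators (p. 391 *"the T′_k-operations are normalized"*) and for the real conditional
expectation of §1; `a k = e^{3 sup|σ|}` as printed in (1.75) p. 380, estimated by `e³` on p. 388/391.  NOT ASSERTED for the
cell's D-terms. [folklore] -/
def Continues (a : ℕ → ℝ) : Prop :=
  ∀ (b : B.Birth) (k : ℕ), B.birthScale b < k → k ≤ B.K → B.size b k ≤ a k * R.pre b k

/-- HYPOTHESIS SHAPE — ADDITIVE ABSORPTION ("budgets add"): a new birth is booked at its birth scale by the dressing's own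
size plus `A` times the pre-step sizes of the births it absorbs: `size b′ j′ ≤ δ b′ + A·Σ_{b ∈ absorbs b′} pre b j′`
(the additive, decay-free format of (1.69) p. 377; `A = 1` in the real sandwich of §1).  NOT ASSERTED. [folklore] -/
def Absorbs (A : ℝ) : Prop :=
  ∀ b' : B.Birth, B.size b' (B.birthScale b') ≤ R.δ b' + A * ∑ b ∈ R.absorbs b', R.pre b (B.birthScale b')

/-- HYPOTHESIS SHAPE — FELT-HOME (the counting shadow of "localisation domains stay ordinary" / X2's obligation (B) does
not re-appear): at its birth scale a new birth is felt only on cubes of its component or on cubes where one of the births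
it absorbs was felt — no tube-relative positions (p. 391: the domains Y_i *"are fixed"*).  NOT ASSERTED. [folklore] -/
def FeltHome : Prop :=
  ∀ (b' : B.Birth) (q : B.Cube), b' ∈ B.feltAt q → B.cubeScale q = B.birthScale b' →
    q ∈ R.comp b' ∨ ∃ b ∈ R.absorbs b', b ∈ B.feltAt q

/-- THE ROW'S `Prop` — PRESERVED UNDER ℝ: the class of row O3.E-iii-a is reproduced by the later ℝ-step `R` with
continuation cost `a` and absorption constant `A`: CONTINUATION ∧ ADDITIVE ABSORPTION ∧ FELT-HOME.  A HYPOTHESIS SHAPE the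
rows O3.E-iii-b (T-step) and U5b.E quantify over; that Bałaban's (1.65)–(1.75) mechanism realises it for the cell's dressed
D-terms is the EST content recorded, with located obligations, in `t4/T4-EST-O3Eiiic.md` — NOT ASSERTED here. [folklore] -/
def PreservedUnderR (a : ℕ → ℝ) (A : ℝ) : Prop :=
  R.Continues a ∧ R.Absorbs A ∧ R.FeltHome

/-- The PRE-LOAD of birth scale `j` at cube `q`: `Σ_{b felt at q, born at j} pre b (scale of q)`. [folklore] -/
def preload (q : B.Cube) (j : ℕ) : ℝ :=
  ∑ b ∈ B.feltOfScale q j, R.pre b (B.cubeScale q)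

/-- HYPOTHESIS SHAPE — unweighted pre-step mass of the OLD births felt at a cube: `Σ_{b felt at q, born before the scale of q}
pre b ≤ c`. [folklore] -/
def PreBudget (c : ℝ) : Prop :=
  ∀ q : B.Cube, ∑ b ∈ (B.feltAt q).filter (fun b => B.birthScale b < B.cubeScale q), R.pre b (B.cubeScale q) ≤ c

/-- HYPOTHESIS SHAPE — weighted pre-step budget of the old birth scales at a cube (the pre-step (TOB-k) without the top
scale): `Σ_{j < scale q} w j · preload q j ≤ c`. [folklore] -/
def PreBudgetW (w : ℕ → ℝ) (c : ℝ) : Prop :=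
  ∀ q : B.Cube, ∑ j ∈ range (B.cubeScale q), w j * R.preload q j ≤ c

/-- HYPOTHESIS SHAPE — COMPONENT VOLUME: a renormalised component (with collars) has at most `v` cubes (the smallness of
the components of the large-field region is the geometric input recorded by the lineage module `B16PostRGeom`; not
restated here). [folklore] -/
def CompVol (v : ℕ) : Prop :=
  ∀ b' : B.Birth, (R.comp b').card ≤ v

/-- HYPOTHESIS SHAPE — the dressing's own per-cube budget for the new births: `Σ_{b′ felt at q, born at the scale of q} δ b′
≤ Δ` (currency of rows O3b.K / O3.E-i′). [folklore] -/
def DeltaBudget (Δ : ℝ) : Prop :=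
  ∀ q : B.Cube, ∑ b' ∈ B.feltOfScale q (B.cubeScale q), R.δ b' ≤ Δ

/-- HYPOTHESIS SHAPE — COMPONENT COUNT: at most `ν₁` new births have a given cube in their component (births at one
component: one per unit loop dressed there). [folklore] -/
def CompCount (ν₁ : ℕ) : Prop :=
  ∀ (q : B.Cube) (s : Finset B.Birth), (∀ b' ∈ s, q ∈ R.comp b') → s.card ≤ ν₁

/-- HYPOTHESIS SHAPE — ABSORPTION FAN-IN: an old birth is absorbed by at most `η` new births (its scale-`k` branch has
≤ m₀ cubes, `Booking.BranchLocal`, hence meets boundedly many components). [folklore] -/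
def FanIn (η : ℕ) : Prop :=
  ∀ (b : B.Birth) (s : Finset B.Birth), (∀ b' ∈ s, b ∈ R.absorbs b') → s.card ≤ η

/-- HYPOTHESIS SHAPE — the ONE-T-STEP shape of row O3.E-iii-b delivering the pre-ℝ sizes: a size bound `σ j k` after
scale `k` yields the pre-step bound `π j (k+1)` before the ℝ-operation of scale `k+1`. [folklore] -/
def TShape (σ π : ℕ → ℕ → ℝ) : Prop :=
  ∀ (b : B.Birth) (k : ℕ), B.birthScale b ≤ k → k < B.K →
    B.size b k ≤ σ (B.birthScale b) k → R.pre b (k + 1) ≤ π (B.birthScale b) (k + 1)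

/-- HYPOTHESIS SHAPE — the simplest T-step instance: the T-step does not increase the booked size. [folklore] -/
def TNonexpansive : Prop :=
  ∀ (b : B.Birth) (k : ℕ), B.birthScale b ≤ k → k < B.K → R.pre b (k + 1) ≤ B.size b k

/-! ## §3 Kernel bookkeeping: budgets add, sizes multiply, no new positions -/

variable {R}

/-- The pre-load is nonnegative. [folklore] -/
theorem preload_nonneg (q : B.Cube) (j : ℕ) : 0 ≤ R.preload q j :=
  sum_nonneg fun b _ => R.pre_nonneg b _

/-- RE-CONCENTRATION, fiberwise: the pre-mass absorbed by a new birth is at most the old pre-load summed over the cubes of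
its component (each absorbed birth is felt at some component cube and was born earlier). [folklore] -/
theorem absorbed_le (b' : B.Birth) :
    ∑ b ∈ R.absorbs b', R.pre b (B.birthScale b')
      ≤ ∑ q ∈ R.comp b', ∑ b ∈ (B.feltAt q).filter (fun b => B.birthScale b < B.cubeScale q),
          R.pre b (B.cubeScale q) := by
  classical
  calc ∑ b ∈ R.absorbs b', R.pre b (B.birthScale b')
      ≤ ∑ b ∈ R.absorbs b', ∑ q ∈ R.comp b', (if b ∈ B.feltAt q then R.pre b (B.birthScale b') else 0) := by
        refine sum_le_sum fun b hb => ?_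
        obtain ⟨q, hq, hbq⟩ := R.absorbs_felt b' b hb
        have h1 := single_le_sum (s := R.comp b')
          (f := fun q' => if b ∈ B.feltAt q' then R.pre b (B.birthScale b') else 0)
          (fun q' _ => by
            show (0 : ℝ) ≤ if b ∈ B.feltAt q' then R.pre b (B.birthScale b') else 0
            split_ifs
            · exact R.pre_nonneg _ _
            · exact le_rfl) hq
        simp only [if_pos hbq] at h1
        exact h1
    _ = ∑ q ∈ R.comp b', ∑ b ∈ R.absorbs b', (if b ∈ B.feltAt q then R.pre b (B.birthScale b') else 0) :=
        sum_comm
    _ = ∑ q ∈ R.comp b', ∑ b ∈ (R.absorbs b').filter (fun b => b ∈ B.feltAt q), R.pre b (B.birthScale b') := by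
        refine sum_congr rfl fun q _ => ?_
        rw [sum_filter]
    _ ≤ ∑ q ∈ R.comp b', ∑ b ∈ (B.feltAt q).filter (fun b => B.birthScale b < B.cubeScale q),
          R.pre b (B.cubeScale q) := by
        refine sum_le_sum fun q hq => ?_
        rw [R.comp_scale b' q hq]
        refine sum_le_sum_of_subset_of_nonneg ?_ (fun b _ _ => R.pre_nonneg _ _)
        intro b hb
        rw [mem_filter] at hb ⊢
        exact ⟨hb.2, R.absorbs_lt b' b hb.1⟩

/-- RE-CONCENTRATION, booked: under ADDITIVE ABSORPTION, a pre-budget `c` per cube and component volume `v`, a new birth is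
booked at `≤ δ b′ + A·(v·c)` — it collects the pre-loads of ALL cubes of its component (located obligation of the EST
record: `A·v·(pre-budget)` must fit the per-cube budget). [folklore] -/
theorem birth_le_of_budget {A c : ℝ} {v : ℕ} (hA : R.Absorbs A) (hA0 : 0 ≤ A) (hP : R.PreBudget c) (hc : 0 ≤ c)
    (hV : R.CompVol v) (b' : B.Birth) : B.size b' (B.birthScale b') ≤ R.δ b' + A * (v * c) := by
  refine (hA b').trans (add_le_add le_rfl (mul_le_mul_of_nonneg_left ?_ hA0))
  calc ∑ b ∈ R.absorbs b', R.pre b (B.birthScale b')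
      ≤ ∑ q ∈ R.comp b', ∑ b ∈ (B.feltAt q).filter (fun b => B.birthScale b < B.cubeScale q),
          R.pre b (B.cubeScale q) := absorbed_le b'
    _ ≤ ∑ q ∈ R.comp b', c := sum_le_sum fun q _ => hP q
    _ = (R.comp b').card * c := by rw [sum_const, nsmul_eq_mul]
    _ ≤ v * c := mul_le_mul_of_nonneg_right (by exact_mod_cast hV b') hc

/-- CONTINUATION, per cube and old scale: `load q j ≤ a k · preload q j` for `j < k = scale q`. [folklore] -/
theorem load_le_preload {a : ℕ → ℝ} (hR : R.Continues a) (q : B.Cube) {j : ℕ} (hj : j < B.cubeScale q) :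
    B.load q j ≤ a (B.cubeScale q) * R.preload q j := by
  unfold Booking.load preload
  rw [mul_sum]
  refine sum_le_sum fun b hb => ?_
  obtain ⟨_, hb2⟩ := Booking.mem_feltOfScale.mp hb
  exact hR b _ (by rw [hb2]; exact hj) (B.cube_le q)

/-- THE NEW SCALE'S LOAD after the step: `load q (scale q) ≤ Δ + ν·(A·(v·c))`. [folklore] -/
theorem newLoad_le {A c Δ ν : ℝ} {v : ℕ} (hA : R.Absorbs A) (hA0 : 0 ≤ A) (hP : R.PreBudget c) (hc : 0 ≤ c)
    (hV : R.CompVol v) (hΔ : R.DeltaBudget Δ) (hν : NewCount B ν) (q : B.Cube) :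
    B.load q (B.cubeScale q) ≤ Δ + ν * (A * (v * c)) := by
  unfold Booking.load
  have key : ∀ b' ∈ B.feltOfScale q (B.cubeScale q), B.size b' (B.cubeScale q) ≤ R.δ b' + A * (v * c) := by
    intro b' hb'
    obtain ⟨_, hb2⟩ := Booking.mem_feltOfScale.mp hb'
    rw [← hb2]
    exact birth_le_of_budget hA hA0 hP hc hV b'
  have hx : 0 ≤ A * (v * c) := mul_nonneg hA0 (mul_nonneg (Nat.cast_nonneg _) hc)
  calc ∑ b' ∈ B.feltOfScale q (B.cubeScale q), B.size b' (B.cubeScale q)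
      ≤ ∑ b' ∈ B.feltOfScale q (B.cubeScale q), (R.δ b' + A * (v * c)) := sum_le_sum key
    _ = (∑ b' ∈ B.feltOfScale q (B.cubeScale q), R.δ b')
          + ((B.feltOfScale q (B.cubeScale q)).card : ℝ) * (A * (v * c)) := by
        rw [sum_add_distrib, sum_const, nsmul_eq_mul]
    _ ≤ Δ + ν * (A * (v * c)) := add_le_add (hΔ q) (mul_le_mul_of_nonneg_right (hν q) hx)

/-- **BUDGETS ADD** — the per-cube budget after the step: CONTINUATION at cost `a k ≤ ā` on the old scales (weighted
pre-budget `c_w`) plus the new scale (dressing budget `Δ`, re-concentrated absorbed mass `ν·A·v·c`, weights `≤ 1`) give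
`CubeBudget w (ā·c_w + (Δ + ν·(A·(v·c))))` for the post-step booking. [folklore] -/
theorem cubeBudget_after {a w : ℕ → ℝ} {ā cw A c Δ ν : ℝ} {v : ℕ}
    (hR : R.Continues a) (ha : ∀ k, 0 ≤ a k) (hā : ∀ k, a k ≤ ā)
    (hw0 : ∀ j, 0 ≤ w j) (hw1 : ∀ j, w j ≤ 1) (hPW : R.PreBudgetW w cw)
    (hA : R.Absorbs A) (hA0 : 0 ≤ A) (hP : R.PreBudget c) (hc : 0 ≤ c) (hV : R.CompVol v)
    (hΔ : R.DeltaBudget Δ) (hν : NewCount B ν) :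
    B.CubeBudget w (ā * cw + (Δ + ν * (A * (v * c)))) := by
  intro q
  rw [sum_range_succ]
  refine add_le_add ?_ ?_
  · have hā0 : 0 ≤ ā := (ha 0).trans (hā 0)
    calc ∑ j ∈ range (B.cubeScale q), w j * B.load q j
        ≤ ∑ j ∈ range (B.cubeScale q), w j * (a (B.cubeScale q) * R.preload q j) :=
          sum_le_sum fun j hj => mul_le_mul_of_nonneg_left (load_le_preload hR q (mem_range.mp hj)) (hw0 j)
      _ = a (B.cubeScale q) * ∑ j ∈ range (B.cubeScale q), w j * R.preload q j := by
          rw [mul_sum]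
          exact sum_congr rfl fun j _ => by ring
      _ ≤ ā * cw := mul_le_mul (hā _) (hPW q)
          (sum_nonneg fun j _ => mul_nonneg (hw0 j) (preload_nonneg q j)) hā0
  · have hnew := newLoad_le hA hA0 hP hc hV hΔ hν q
    exact (mul_le_mul_of_nonneg_left hnew (hw0 _)).trans
      (mul_le_of_le_one_left ((Booking.load_nonneg q _).trans hnew) (hw1 _))

/-- T-SHAPE ∘ ℝ-CONTINUATION feed the induction of row O3.E-iii-a (`Booking.sizeBound_of_step`): a birth bound, the
one-T-step shape `σ ↦ π`, continuation at cost `a` and the compatibility `a (k+1)·π j (k+1) ≤ σ j (k+1)` give `SizeBound σ`.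
[folklore] -/
theorem sizeBound_of_TR {σ π : ℕ → ℕ → ℝ} {a : ℕ → ℝ}
    (h0 : ∀ b : B.Birth, B.size b (B.birthScale b) ≤ σ (B.birthScale b) (B.birthScale b))
    (hT : R.TShape σ π) (hR : R.Continues a) (ha : ∀ k, 0 ≤ a k)
    (hcomp : ∀ j k, j ≤ k → k < B.K → a (k + 1) * π j (k + 1) ≤ σ j (k + 1)) : B.SizeBound σ :=
  Booking.sizeBound_of_step h0 fun b k hjk hk hs =>
    calc B.size b (k + 1) ≤ a (k + 1) * R.pre b (k + 1) :=
          hR b (k + 1) (Nat.lt_succ_of_le hjk) (Nat.succ_le_of_lt hk)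
      _ ≤ a (k + 1) * π (B.birthScale b) (k + 1) := mul_le_mul_of_nonneg_left (hT b k hjk hk hs) (ha _)
      _ ≤ σ (B.birthScale b) (k + 1) := hcomp _ k hjk hk

/-- **SIZES MULTIPLY along the history**: a birth bound `S j`, a non-expansive T-step and continuation at a uniform
per-step cost `a k ≤ α` give `size b k ≤ α^{k−j}·S j` — the ℝ-cost enters the size array as a per-later-step GAIN `α`.
[folklore] -/
theorem sizeBound_geometric {S : ℕ → ℝ} {a : ℕ → ℝ} {α : ℝ}
    (h0 : ∀ b : B.Birth, B.size b (B.birthScale b) ≤ S (B.birthScale b))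
    (hT : R.TNonexpansive) (hR : R.Continues a) (ha : ∀ k, 0 ≤ a k) (haα : ∀ k, a k ≤ α) :
    B.SizeBound (fun j k => α ^ (k - j) * S j) := by
  refine Booking.sizeBound_of_step (fun b => by simpa using h0 b) fun b k hjk hk hs => ?_
  have hS : 0 ≤ α ^ (k - B.birthScale b) * S (B.birthScale b) := (B.size_nonneg b k).trans hs
  calc B.size b (k + 1) ≤ a (k + 1) * R.pre b (k + 1) :=
        hR b (k + 1) (Nat.lt_succ_of_le hjk) (Nat.succ_le_of_lt hk)
    _ ≤ a (k + 1) * (α ^ (k - B.birthScale b) * S (B.birthScale b)) :=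
        mul_le_mul_of_nonneg_left ((hT b k hjk hk).trans hs) (ha _)
    _ ≤ α * (α ^ (k - B.birthScale b) * S (B.birthScale b)) := mul_le_mul_of_nonneg_right (haα _) hS
    _ = α ^ (k + 1 - B.birthScale b) * S (B.birthScale b) := by
        rw [Nat.sub_add_comm hjk, pow_succ]
        ring

/-- The RATE form consumed by `Booking.cubeBudget_of_twoRate` (gain `φ := α`): with a birth bound `S j ≤ A₀·τ^{K−j}`,
`SizeBound (fun j k => A₀·α^{k−j}·τ^{K−j})` — so the budget (TOB-k) closes after the later ℝ-steps only under the extra rate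
condition `Λ·α·τ ≤ 1` of that theorem: the printed cost factor (e³ per component, p. 388/391) is paid in the rate.
[folklore] -/
theorem sizeBound_twoRate {S : ℕ → ℝ} {a : ℕ → ℝ} {α A₀ τ : ℝ}
    (h0 : ∀ b : B.Birth, B.size b (B.birthScale b) ≤ S (B.birthScale b))
    (hT : R.TNonexpansive) (hR : R.Continues a) (ha : ∀ k, 0 ≤ a k) (haα : ∀ k, a k ≤ α) (hα : 0 ≤ α)
    (hS : ∀ j ≤ B.K, S j ≤ A₀ * τ ^ (B.K - j)) :
    B.SizeBound (fun j k => A₀ * α ^ (k - j) * τ ^ (B.K - j)) :=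
  (sizeBound_geometric h0 hT hR ha haα).mono fun j k hjk hk => by
    show α ^ (k - j) * S j ≤ A₀ * α ^ (k - j) * τ ^ (B.K - j)
    calc α ^ (k - j) * S j ≤ α ^ (k - j) * (A₀ * τ ^ (B.K - j)) :=
          mul_le_mul_of_nonneg_left (hS j (hjk.trans hk)) (pow_nonneg hα _)
      _ = A₀ * α ^ (k - j) * τ ^ (B.K - j) := by ring

/-- **NO NEW POSITIONS** (X2's obligation (B) does not re-appear, counting shadow): under FELT-HOME, a component count `ν₁`,
absorption fan-in `η` and at most `N₀` OLD births felt at a cube, at most `ν₁ + N₀·η` NEW births (of the cube's scale) are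
felt at any cube — the post-step positional count is generated by component cubes and old felt positions only. [folklore] -/
theorem newCount_of_feltHome (hH : R.FeltHome) {ν₁ η N₀ : ℕ} (hC : R.CompCount ν₁) (hF : R.FanIn η)
    (hN : ∀ q : B.Cube, ((B.feltAt q).filter (fun b => B.birthScale b < B.cubeScale q)).card ≤ N₀)
    (q : B.Cube) : (B.feltOfScale q (B.cubeScale q)).card ≤ ν₁ + N₀ * η := by
  classical
  set s := B.feltOfScale q (B.cubeScale q) with hs
  set old := (B.feltAt q).filter (fun b => B.birthScale b < B.cubeScale q) with hold
  have hsplit := Finset.card_filter_add_card_filter_not (s := s) (fun b' => q ∈ R.comp b')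
  have h1 : (s.filter (fun b' => q ∈ R.comp b')).card ≤ ν₁ :=
    hC q _ (fun b' hb' => (mem_filter.mp hb').2)
  have h2 : (s.filter (fun b' => ¬ q ∈ R.comp b')).card ≤ N₀ * η := by
    have hsub : s.filter (fun b' => ¬ q ∈ R.comp b')
        ⊆ old.biUnion (fun b => s.filter (fun b' => b ∈ R.absorbs b')) := by
      intro b' hb'
      obtain ⟨hb's, hnot⟩ := mem_filter.mp hb'
      obtain ⟨hfelt, hscale⟩ := Booking.mem_feltOfScale.mp hb's
      rcases hH b' q hfelt hscale.symm with hq | ⟨b, hb, hbq⟩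
      · exact absurd hq hnot
      · refine mem_biUnion.mpr ⟨b, ?_, mem_filter.mpr ⟨hb's, hb⟩⟩
        refine mem_filter.mpr ⟨hbq, ?_⟩
        rw [← hscale]
        exact R.absorbs_lt b' b hb
    calc (s.filter (fun b' => ¬ q ∈ R.comp b')).card
        ≤ (old.biUnion (fun b => s.filter (fun b' => b ∈ R.absorbs b'))).card := card_le_card hsub
      _ ≤ ∑ b ∈ old, (s.filter (fun b' => b ∈ R.absorbs b')).card := card_biUnion_le
      _ ≤ ∑ b ∈ old, η := sum_le_sum fun b _ => hF b _ (fun b' hb' => (mem_filter.mp hb').2)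
      _ = old.card * η := by rw [sum_const, smul_eq_mul]
      _ ≤ N₀ * η := Nat.mul_le_mul_right _ (hN q)
  generalize N₀ * η = M at h2 ⊢
  omega

/-- NEW COUNT from the positional count of row O3.E-iii-a (diagonal). [folklore] -/
theorem newCount_of_positionalCount {N : ℕ → ℕ → ℝ} (hN : B.PositionalCount N) {ν : ℝ}
    (hν : ∀ k ≤ B.K, N k k ≤ ν) : NewCount B ν :=
  fun q => (hN q (B.cubeScale q)).trans (hν _ (B.cube_le q))

/-- Unpacking the row's `Prop`. [folklore] -/
theorem PreservedUnderR.continues {a : ℕ → ℝ} {A : ℝ} (h : R.PreservedUnderR a A) : R.Continues a := h.1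

/-- Unpacking the row's `Prop`. [folklore] -/
theorem PreservedUnderR.absorbs {a : ℕ → ℝ} {A : ℝ} (h : R.PreservedUnderR a A) : R.Absorbs A := h.2.1

/-- Unpacking the row's `Prop`. [folklore] -/
theorem PreservedUnderR.feltHome {a : ℕ → ℝ} {A : ℝ} (h : R.PreservedUnderR a A) : R.FeltHome := h.2.2

/-- `Continues` is monotone in the cost. [folklore] -/
theorem Continues.mono {a a' : ℕ → ℝ} (h : R.Continues a) (haa : ∀ k, a k ≤ a' k) : R.Continues a' :=
  fun b k hjk hk => (h b k hjk hk).trans (mul_le_mul_of_nonneg_right (haa k) (R.pre_nonneg b k))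

/-- `Absorbs` is monotone in the constant. [folklore] -/
theorem Absorbs.mono {A A' : ℝ} (h : R.Absorbs A) (hAA : A ≤ A') : R.Absorbs A' :=
  fun b' => (h b').trans (add_le_add le_rfl
    (mul_le_mul_of_nonneg_right hAA (sum_nonneg fun b _ => R.pre_nonneg b _)))

/-- **FELT-HOME FROM BLOCK DATA** (v1.1).  If births and cubes carry block data `dom`, `center` (e.g. the fields of a
`T4FeltGeometry.Anchoring`, whose `felt_under` at scale difference `0` gives `hfelt` by `coarsen_zero`) such that a birth
felt at a cube OF ITS OWN SCALE has the cube's block in its domain, and the step's component cubes `comp b'` contain every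
cube of the birth scale whose block lies in `dom b'`, then `FeltHome` holds — with the first disjunct throughout: under the
NETTED booking (§5; EST record §5 (R-conc)) a new birth is anchored at its component alone. [folklore] -/
theorem feltHome_of_anchor {X : Type*} (dom : B.Birth → Finset X) (center : B.Cube → X)
    (hfelt : ∀ b' q, b' ∈ B.feltAt q → B.cubeScale q = B.birthScale b' → center q ∈ dom b')
    (hcomp : ∀ b' q, B.cubeScale q = B.birthScale b' → center q ∈ dom b' → q ∈ R.comp b') :
    R.FeltHome :=
  fun b' q hb hq => Or.inl (hcomp b' q hq (hfelt b' q hb hq))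

/-! ## §3b (v1.2) The gated seam with `T4GatedBooking`: a later ℝ-step composes inside one gated step -/

variable (R) in
/-- HYPOTHESIS SHAPE — GATED T-SHAPE (v1.2): the T-step of scale `k → k+1` maps a term of size `≤ σ j k` to pre-ℝ size
`≤ π j (k+1)` PROVIDED the scale-`k` gate holds (e.g. `Gate k = T4GatedBooking.CubeBudgetAt B w c k ∧ H k`: the T-step
estimate at `k` consumes the budget (TOB-k), which consumes the sizes at `k` — the circularity `T4GatedBooking` runs as a
strong induction).  Row O3.E-iii-b's to deliver; NOT ASSERTED. [folklore] -/
def TShapeGated (σ π : ℕ → ℕ → ℝ) (Gate : ℕ → Prop) : Prop :=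
  ∀ (b : B.Birth) (k : ℕ), B.birthScale b ≤ k → k < B.K → Gate k →
    B.size b k ≤ σ (B.birthScale b) k → R.pre b (k + 1) ≤ π (B.birthScale b) (k + 1)

/-- An ungated T-shape is a gated one for every gate. [folklore] -/
theorem tShapeGated_of_tShape {σ π : ℕ → ℕ → ℝ} (h : R.TShape σ π) (Gate : ℕ → Prop) :
    R.TShapeGated σ π Gate :=
  fun b k hb hk _ hs => h b k hb hk hs

/-- **THE SEAM** (v1.2): a gated T-shape, the continuation cost `a` of the ℝ-step (sizes multiply) and the rate
compatibility `a (k+1)·π j (k+1) ≤ σ j (k+1)` give `T4GatedBooking.GatedStep B σ Gate` — the later ℝ-step is composed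
INSIDE the one gated step of scale `k → k+1`; no second step hypothesis per scale is needed. [folklore] -/
theorem gatedStep_of_TR {σ π : ℕ → ℕ → ℝ} {a : ℕ → ℝ} {Gate : ℕ → Prop}
    (hT : R.TShapeGated σ π Gate) (hR : R.Continues a) (ha : ∀ k, 0 ≤ a k)
    (hcomp : ∀ j k, j ≤ k → k < B.K → a (k + 1) * π j (k + 1) ≤ σ j (k + 1)) :
    T4GatedBooking.GatedStep B σ Gate := by
  intro k hk hg hP b hb
  calc B.size b (k + 1) ≤ a (k + 1) * R.pre b (k + 1) :=
        hR b (k + 1) (Nat.lt_succ_of_le hb) (Nat.succ_le_of_lt hk)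
    _ ≤ a (k + 1) * π (B.birthScale b) (k + 1) :=
        mul_le_mul_of_nonneg_left (hT b k hb hk hg (hP b hb)) (ha _)
    _ ≤ σ (B.birthScale b) (k + 1) := hcomp _ k hb hk

/-- **ASSEMBLED** (v1.2): positional counts `N`, a tube budget for `N·σ`, a further gate `H` met from the sizes, the birth
bound for `σ`, a T-shape gated by `(TOB-k) ∧ H k`, and the ℝ-continuation close the strong induction of `T4GatedBooking`:
`SizeBound σ ∧ CubeBudget w c ∧ ∀ k ≤ K, H k`.  Which `σ, π, a, N, w, c` the cell's terms meet is NOT asserted. [folklore] -/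
theorem sizeBound_cubeBudget_of_TR_gated {N σ π : ℕ → ℕ → ℝ} {a w : ℕ → ℝ} {c : ℝ} {H : ℕ → Prop}
    (h0 : T4GatedBooking.BirthBound B σ) (hw : ∀ j, j ≤ B.K → 0 ≤ w j) (hN : B.PositionalCount N)
    (hσ0 : ∀ j k, 0 ≤ σ j k) (hTB : T4TubeBudget.TubeBudget B.K w (fun j k => N j k * σ j k) c)
    (hH : T4GatedBooking.GateOfSizes B σ H)
    (hT : R.TShapeGated σ π (fun k => T4GatedBooking.CubeBudgetAt B w c k ∧ H k)) (hR : R.Continues a)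
    (ha : ∀ k, 0 ≤ a k) (hcomp : ∀ j k, j ≤ k → k < B.K → a (k + 1) * π j (k + 1) ≤ σ j (k + 1)) :
    B.SizeBound σ ∧ B.CubeBudget w c ∧ ∀ k, k ≤ B.K → H k :=
  T4GatedBooking.sizeBound_cubeBudget_of_gatedStep h0 hw hN hσ0 hTB hH (gatedStep_of_TR hT hR ha hcomp)

end RStep

/-! ## §4 Non-vacuity: the empty ℝ-step over the empty booking -/

/-- The empty ℝ-step over `Booking.vacuum K` (no births). [folklore] -/
def RStep.vacuum (K : ℕ) : RStep (Booking.vacuum K) where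
  pre := fun b => nomatch b
  pre_nonneg := fun b => nomatch b
  absorbs := fun b => nomatch b
  absorbs_lt := fun b => nomatch b
  comp := fun b => nomatch b
  comp_scale := fun b => nomatch b
  absorbs_felt := fun b => nomatch b
  δ := fun b => nomatch b
  δ_nonneg := fun b => nomatch b

/-- The empty ℝ-step is preserved under ℝ for any cost and constant (non-vacuity of the shapes, nothing more). [folklore] -/
theorem vacuum_preservedUnderR (K : ℕ) (a : ℕ → ℝ) (A : ℝ) : (RStep.vacuum K).PreservedUnderR a A := by
  refine ⟨?_, ?_, ?_⟩
  · intro b; exact nomatch b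
  · intro b; exact nomatch b
  · intro b; exact nomatch b

/-! ## §5 (v1.1) The NETTED booking on a real fibre: first cumulants add and are re-attributed, the genuinely new
mass of a birth is second order [folklore]

Located obligation (R-conc) of the EST record (`t4/T4-EST-O3Eiiic.md` §5; GAPS G-b02g7-1): with the naive additive
booking (`Absorbs A` with `A = a_k ≥ 1`) the absorbed mass re-concentrates (`RStep.birth_le_of_budget`) and the per-cube
budget is not reproduced.  The booking that can reproduce it NETS the first cumulants: the continuation of an absorbed
old term `D_b` is its normalised expectation `E[D_b]` (size ≤ pre-size, `abs_integral_le_of_abs_le`: `Continues` with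
`a = 1` on a real fibre), and the new birth `N = log E[e^Φ]`, `Φ = ω + Σ_b ΔD_b` (the dressing's own exponent at the
component plus the component-parts of the absorbed terms), minus the returned first cumulants `Σ_b E[ΔD_b]`, is at most
`sup|ω| + (sup|Φ|)²` (`netted_birth_le`) — BUDGETS ADD at first order and go back to the continuations; only second-order
mass is born, i.e. `Absorbs` with `δ = (1+s)·sup|ω|` and absorption constant `A = s = sup|Φ| ≤ 1` (`netted_absorbs_shape`).
The probability measure `μ` STANDS FOR the normalised positive operation of one ℝ-step restricted to a real fibre (B15
(1.102) and p. 176 «the denominators are positive»; kernel `B15.BasicStep.integral_ropReal_eq`) — an ABSTRACTION: that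
identification is not typed here; the complex-exponent version (σ complex, the constants 2 and 3 of (1.74)/(1.75)) is §7
(v1.3), the smallness it needs on the complex domain is located obligation (R-small).  Nothing of B15/B16 is asserted. -/

section Netted

open _root_.MeasureTheory

variable {Ω : Type*} [MeasurableSpace Ω] (μ : Measure Ω) [IsProbabilityMeasure μ]

/-- A measurable real function with `|Φ| ≤ s` everywhere is integrable against a probability measure. [folklore] -/
theorem integrable_of_abs_le {Φ : Ω → ℝ} (hΦ : Measurable Φ) {s : ℝ} (hs : ∀ x, |Φ x| ≤ s) :
    Integrable Φ μ :=
  Integrable.of_mem_Icc (-s) s hΦ.aemeasurable (ae_of_all μ fun x => Set.mem_Icc.2 (abs_le.1 (hs x)))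

/-- … and so is its exponential (bounded between `e^{−s}` and `e^{s}`). [folklore] -/
theorem integrable_exp_of_abs_le {Φ : Ω → ℝ} (hΦ : Measurable Φ) {s : ℝ} (hs : ∀ x, |Φ x| ≤ s) :
    Integrable (fun x => Real.exp (Φ x)) μ :=
  Integrable.of_mem_Icc (Real.exp (-s)) (Real.exp s) (Real.measurable_exp.comp hΦ).aemeasurable
    (ae_of_all μ fun x => Set.mem_Icc.2
      ⟨Real.exp_le_exp.2 (abs_le.1 (hs x)).1, Real.exp_le_exp.2 (abs_le.1 (hs x)).2⟩)

/-- **CONTINUATION SIZE ≤ PRE-SIZE** (`Continues` with `a = 1` on a real fibre): `|E[D]| ≤ sup|D|`. [folklore] -/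
theorem abs_integral_le_of_abs_le {D : Ω → ℝ} {s : ℝ} (hs : ∀ x, |D x| ≤ s) : |∫ x, D x ∂μ| ≤ s := by
  have h := norm_integral_le_of_norm_le_const (μ := μ) (f := D) (C := s)
    (ae_of_all μ fun x => by rw [Real.norm_eq_abs]; exact hs x)
  rwa [Real.norm_eq_abs, probReal_univ, mul_one] at h

/-- The inner expectation of a birth is positive: `0 < e^{E[Φ]} ≤ E[e^Φ]` (Jensen). [folklore] -/
theorem exp_integral_le_integral_exp {Φ : Ω → ℝ} (hΦ : Measurable Φ) {s : ℝ} (hs : ∀ x, |Φ x| ≤ s) :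
    Real.exp (∫ x, Φ x ∂μ) ≤ ∫ x, Real.exp (Φ x) ∂μ :=
  convexOn_exp.map_integral_le Real.continuous_exp.continuousOn isClosed_univ
    (ae_of_all μ fun _ => Set.mem_univ _) (integrable_of_abs_le μ hΦ hs) (integrable_exp_of_abs_le μ hΦ hs)

/-- … hence `0 < E[e^Φ]`. [folklore] -/
theorem integral_exp_pos {Φ : Ω → ℝ} (hΦ : Measurable Φ) {s : ℝ} (hs : ∀ x, |Φ x| ≤ s) :
    0 < ∫ x, Real.exp (Φ x) ∂μ :=
  (Real.exp_pos _).trans_le (exp_integral_le_integral_exp μ hΦ hs)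

/-- **JENSEN (lower bound): the first cumulant is below the birth**, `E[Φ] ≤ log E[e^Φ]`. [folklore] -/
theorem integral_le_log_integral_exp {Φ : Ω → ℝ} (hΦ : Measurable Φ) {s : ℝ} (hs : ∀ x, |Φ x| ≤ s) :
    ∫ x, Φ x ∂μ ≤ Real.log (∫ x, Real.exp (Φ x) ∂μ) :=
  calc ∫ x, Φ x ∂μ = Real.log (Real.exp (∫ x, Φ x ∂μ)) := (Real.log_exp _).symm
    _ ≤ Real.log (∫ x, Real.exp (Φ x) ∂μ) :=
      Real.log_le_log (Real.exp_pos _) (exp_integral_le_integral_exp μ hΦ hs)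

/-- **SECOND-ORDER UPPER BOUND: the birth exceeds its first cumulant by at most `(sup|Φ|)²`** (for `sup|Φ| ≤ s ≤ 1`):
`log E[e^Φ] ≤ E[Φ] + s²`, from `e^x ≤ 1 + x + x²` (`|x| ≤ 1`) and `log y ≤ y − 1`. [folklore] -/
theorem log_integral_exp_le {Φ : Ω → ℝ} (hΦ : Measurable Φ) {s : ℝ} (hs1 : s ≤ 1) (hs : ∀ x, |Φ x| ≤ s) :
    Real.log (∫ x, Real.exp (Φ x) ∂μ) ≤ ∫ x, Φ x ∂μ + s ^ 2 := by
  have hpt : ∀ x, Real.exp (Φ x) ≤ 1 + Φ x + s ^ 2 := by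
    intro x
    have h2 := (abs_le.1 (Real.abs_exp_sub_one_sub_id_le ((hs x).trans hs1))).2
    have h3 : Φ x ^ 2 ≤ s ^ 2 := sq_le_sq' (abs_le.1 (hs x)).1 (abs_le.1 (hs x)).2
    linarith
  have hiΦ : Integrable Φ μ := integrable_of_abs_le μ hΦ hs
  have hie : Integrable (fun x => Real.exp (Φ x)) μ := integrable_exp_of_abs_le μ hΦ hs
  have hi1 : Integrable (fun x => 1 + Φ x) μ := (integrable_const (1 : ℝ)).add hiΦ
  have hig : Integrable (fun x => 1 + Φ x + s ^ 2) μ := hi1.add (integrable_const (s ^ 2))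
  have hint : ∫ x, Real.exp (Φ x) ∂μ ≤ ∫ x, (1 + Φ x + s ^ 2) ∂μ := integral_mono hie hig hpt
  have hA : ∫ x, (1 + Φ x + s ^ 2) ∂μ = ∫ x, (1 + Φ x) ∂μ + ∫ _x, s ^ 2 ∂μ := integral_add hi1 (integrable_const _)
  have hB : ∫ x, (1 + Φ x) ∂μ = ∫ _x, (1 : ℝ) ∂μ + ∫ x, Φ x ∂μ := integral_add (integrable_const _) hiΦ
  have hC : ∫ _x, (1 : ℝ) ∂μ = 1 := by rw [integral_const, probReal_univ, one_smul]
  have hD : ∫ _x, s ^ 2 ∂μ = s ^ 2 := by rw [integral_const, probReal_univ, one_smul]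
  calc Real.log (∫ x, Real.exp (Φ x) ∂μ) ≤ ∫ x, Real.exp (Φ x) ∂μ - 1 :=
        Real.log_le_sub_one_of_pos (integral_exp_pos μ hΦ hs)
    _ ≤ ∫ x, Φ x ∂μ + s ^ 2 := by linarith [hint, hA, hB, hC, hD]

/-- **THE NETTED BIRTH.**  `Φ = ω + Σ_{i ∈ I} Δ_i` (the dressing's own exponent at the renormalised component plus the
component-parts of the absorbed old D-terms), `|ω| ≤ s_ω`, `|Δ_i| ≤ S_i`, `s_ω + Σ S_i ≤ 1`: the birth `log E[e^Φ]` minus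
the RETURNED first cumulants `Σ_i E[Δ_i]` is at most `s_ω + (s_ω + Σ_i S_i)²` — first-order budgets ADD and go back to the
continuations (`E[D_i^frozen + Δ_i] = E[D_i]`, size ≤ pre-size by `abs_integral_le_of_abs_le`), the new mass is second
order. [folklore] -/
theorem netted_birth_le {ι : Type*} (I : Finset ι) {ω : Ω → ℝ} {Δ : ι → Ω → ℝ} (hω : Measurable ω)
    (hΔ : ∀ i ∈ I, Measurable (Δ i)) {sω : ℝ} {S : ι → ℝ} (hsω : ∀ x, |ω x| ≤ sω)
    (hS : ∀ i ∈ I, ∀ x, |Δ i x| ≤ S i) (h1 : sω + ∑ i ∈ I, S i ≤ 1) :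
    |Real.log (∫ x, Real.exp (ω x + ∑ i ∈ I, Δ i x) ∂μ) - ∑ i ∈ I, ∫ x, Δ i x ∂μ|
      ≤ sω + (sω + ∑ i ∈ I, S i) ^ 2 := by
  have hΦm : Measurable fun x => ω x + ∑ i ∈ I, Δ i x := hω.add (Finset.measurable_sum I hΔ)
  have hΦb : ∀ x, |ω x + ∑ i ∈ I, Δ i x| ≤ sω + ∑ i ∈ I, S i := fun x =>
    (abs_add_le _ _).trans (add_le_add (hsω x)
      ((Finset.abs_sum_le_sum_abs _ _).trans (Finset.sum_le_sum fun i hi => hS i hi x)))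
  have hlow := integral_le_log_integral_exp μ hΦm hΦb
  have hup := log_integral_exp_le μ hΦm h1 hΦb
  have hiω : Integrable ω μ := integrable_of_abs_le μ hω hsω
  have hiΔ : ∀ i ∈ I, Integrable (Δ i) μ := fun i hi => integrable_of_abs_le μ (hΔ i hi) (hS i hi)
  have hisum : Integrable (fun x => ∑ i ∈ I, Δ i x) μ := integrable_finsetSum I hiΔ
  have hA : ∫ x, (ω x + ∑ i ∈ I, Δ i x) ∂μ = ∫ x, ω x ∂μ + ∫ x, (∑ i ∈ I, Δ i x) ∂μ := integral_add hiω hisum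
  have hB : ∫ x, (∑ i ∈ I, Δ i x) ∂μ = ∑ i ∈ I, ∫ x, Δ i x ∂μ := integral_finsetSum I hiΔ
  have hωI := abs_le.1 (abs_integral_le_of_abs_le μ hsω)
  have hsq : 0 ≤ (sω + ∑ i ∈ I, S i) ^ 2 := sq_nonneg _
  rw [abs_le]
  constructor
  · linarith [hωI.1]
  · linarith [hωI.2]

/-- Reading `netted_birth_le` as the `Absorbs` shape of §2: with `S = Σ pre-sizes of the absorbed births` and
`s = s_ω + S ≤ 1`, `s_ω + s² = (1 + s)·s_ω + s·S` — i.e. `Absorbs` with `δ = (1+s)·s_ω ≤ 2·s_ω` and absorption constant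
`A = s` (the total exponent's sup: SMALL), in place of the naive `A = a_k ≥ 1` of the additive booking. [folklore] -/
theorem netted_absorbs_shape (sω S : ℝ) :
    sω + (sω + S) ^ 2 = (1 + (sω + S)) * sω + (sω + S) * S := by
  ring

end Netted

/-! ## §6 (v1.2) Iterating the per-cube budget along the later ℝ-steps: discrete Grönwall

The constant of `cubeBudget_after` iterates as `c_{k+1} ≤ (1 + ε_k)·c_k + Δ_k` with `ε_k = ν·v·s_k` (the NETTED absorption
constant of §5, `s_k = sup|Φ_k|` on the fibre) and `Δ_k` the dressings' own new sizes; the budget constant is then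
K-uniform iff `Σ_k ε_k` and `Σ_k Δ_k` are K-uniformly bounded.  Pure real analysis; which `ε_k, Δ_k` the cell's terms
produce is NOT asserted (located obligation (iii) of GAPS C-b02g7-2). -/

section Gronwall

/-- **DISCRETE GRÖNWALL** (v1.2): `c (k+1) ≤ (1 + ε k)·c k + Δ k` with `ε, Δ ≥ 0` and `c 0 ≥ 0` gives
`c n ≤ exp(Σ_{k<n} ε k)·(c 0 + Σ_{k<n} Δ k)` for every `n` (from `1 + x ≤ eˣ`). [folklore] -/
theorem discreteGronwall {c ε Δ : ℕ → ℝ} (hε : ∀ k, 0 ≤ ε k) (hΔ : ∀ k, 0 ≤ Δ k) (hc0 : 0 ≤ c 0)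
    (hrec : ∀ k, c (k + 1) ≤ (1 + ε k) * c k + Δ k) :
    ∀ n, c n ≤ Real.exp (∑ k ∈ range n, ε k) * (c 0 + ∑ k ∈ range n, Δ k) := by
  intro n
  induction n with
  | zero => simp
  | succ n ih =>
    have hS : 0 ≤ c 0 + ∑ k ∈ range n, Δ k := add_nonneg hc0 (sum_nonneg fun k _ => hΔ k)
    have hE : 0 ≤ Real.exp (∑ k ∈ range n, ε k) := (Real.exp_pos _).le
    have h1 : (1 + ε n) * c n ≤ (1 + ε n) * (Real.exp (∑ k ∈ range n, ε k) * (c 0 + ∑ k ∈ range n, Δ k)) :=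
      mul_le_mul_of_nonneg_left ih (by linarith [hε n])
    have h2 : (1 + ε n) ≤ Real.exp (ε n) := by have := Real.add_one_le_exp (ε n); linarith
    have hE1 : 1 ≤ Real.exp (∑ k ∈ range n, ε k) * Real.exp (ε n) := by
      rw [← Real.exp_add]; exact Real.one_le_exp (add_nonneg (sum_nonneg fun k _ => hε k) (hε n))
    rw [sum_range_succ, sum_range_succ, Real.exp_add]
    calc c (n + 1) ≤ (1 + ε n) * c n + Δ n := hrec n
      _ ≤ (1 + ε n) * (Real.exp (∑ k ∈ range n, ε k) * (c 0 + ∑ k ∈ range n, Δ k)) + Δ n := by linarith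
      _ ≤ Real.exp (ε n) * (Real.exp (∑ k ∈ range n, ε k) * (c 0 + ∑ k ∈ range n, Δ k)) + Δ n := by
          have := mul_le_mul_of_nonneg_right h2 (mul_nonneg hE hS); linarith
      _ ≤ Real.exp (ε n) * (Real.exp (∑ k ∈ range n, ε k) * (c 0 + ∑ k ∈ range n, Δ k))
            + (Real.exp (∑ k ∈ range n, ε k) * Real.exp (ε n)) * Δ n := by
          have := le_mul_of_one_le_left (hΔ n) hE1; linarith
      _ = Real.exp (∑ k ∈ range n, ε k) * Real.exp (ε n) * (c 0 + (∑ k ∈ range n, Δ k + Δ n)) := by ring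

/-- K-UNIFORM COROLLARY: uniformly summable `ε` (total `≤ E`) and `Δ` (total `≤ D`) keep `c n ≤ e^E (c 0 + D)` for all
`n` — the shape of "the per-cube budget constant stays K-uniform along the later ℝ-steps". [folklore] -/
theorem discreteGronwall_uniform {c ε Δ : ℕ → ℝ} {E D : ℝ} (hε : ∀ k, 0 ≤ ε k) (hΔ : ∀ k, 0 ≤ Δ k)
    (hc0 : 0 ≤ c 0) (hrec : ∀ k, c (k + 1) ≤ (1 + ε k) * c k + Δ k)
    (hE : ∀ n, ∑ k ∈ range n, ε k ≤ E) (hD : ∀ n, ∑ k ∈ range n, Δ k ≤ D) (n : ℕ) :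
    c n ≤ Real.exp E * (c 0 + D) :=
  (discreteGronwall hε hΔ hc0 hrec n).trans
    (mul_le_mul (Real.exp_le_exp.mpr (hE n)) (add_le_add le_rfl (hD n))
      (add_nonneg hc0 (sum_nonneg fun k _ => hΔ k)) (Real.exp_pos _).le)

end Gronwall

/-! ## §7 (v1.3) The NETTED booking on a COMPLEX fibre: the constants 2 and 3 of (1.74)/(1.75) in the abstraction,
and the complex netted birth is second order [folklore]

The abstraction of B16 p. 380 (1.73)–(1.75): *"|T′_k(X,(U,J))F| = |T′_k(X,(U,0))e^σF| ≤ …"* — the base operation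
`T′_k(X,(U,0))` is POSITIVE (*"obviously positive, although it may be very small"*) and is normalised by `T′_k(X,(U,0))1`
(↦ a probability measure `μ`); the whole complex `(U,J)`-dependence sits in the exponent `σ` (↦ a measurable `Φ : Ω → ℂ`,
`‖Φ‖ ≤ s`).  Then `‖E[e^Φ]‖ ≥ e^{−2s}` (the 2 of (1.74)), `‖E[e^Φ F]‖ ≤ e^{3s}·sup‖F‖·‖E[e^Φ]‖` (the 3 of (1.75): sizes
multiply with `a = e^{3s}`), and the NETTED birth `log E[e^Φ]` minus the returned first cumulants is `≤ s_ω + 3(sup‖Φ‖)²`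
(`netted_birth_le_complex`): on a complex fibre too, budgets add at first order and only second-order mass is born.  The
smallness `sup‖Φ‖ ≤ 1/4` ON THE COMPLEX DOMAIN is located obligation (R-small) of the EST record; the identification of
`μ` with the cell's operation is not typed; nothing of B16 is asserted (for finite positive functionals the pointwise
(1.73)–(1.75) are kernel in `B16.lean`: `ineq173`–`ineq175`, not imported here). -/

section ComplexNetted

open _root_.MeasureTheory

variable {Ω : Type*} [MeasurableSpace Ω] (μ : Measure Ω) [IsProbabilityMeasure μ]

/-- A measurable complex function with `‖Φ‖ ≤ s` everywhere is integrable against a probability measure. [folklore] -/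
theorem integrable_of_norm_le {Φ : Ω → ℂ} (hΦ : Measurable Φ) {s : ℝ} (hs : ∀ x, ‖Φ x‖ ≤ s) :
    Integrable Φ μ :=
  (integrable_const s).mono' hΦ.aestronglyMeasurable (ae_of_all μ hs)

/-- … and so is its complex exponential (`‖e^Φ‖ = e^{Re Φ} ≤ e^{s}`). [folklore] -/
theorem integrable_cexp_of_norm_le {Φ : Ω → ℂ} (hΦ : Measurable Φ) {s : ℝ} (hs : ∀ x, ‖Φ x‖ ≤ s) :
    Integrable (fun x => Complex.exp (Φ x)) μ :=
  (integrable_const (Real.exp s)).mono' (Complex.measurable_exp.comp hΦ).aestronglyMeasurable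
    (ae_of_all μ fun x => by
      rw [Complex.norm_exp]
      exact Real.exp_le_exp.2 ((Complex.re_le_norm _).trans (hs x)))

/-- **CONTINUATION SIZE ≤ PRE-SIZE**, complex fibre: `‖E[D]‖ ≤ sup‖D‖`. [folklore] -/
theorem norm_integral_le_of_norm_le_prob {D : Ω → ℂ} {s : ℝ} (hs : ∀ x, ‖D x‖ ≤ s) : ‖∫ x, D x ∂μ‖ ≤ s := by
  have h := norm_integral_le_of_norm_le_const (μ := μ) (f := D) (C := s) (ae_of_all μ hs)
  rwa [probReal_univ, mul_one] at h

/-- **SECOND ORDER**, complex fibre: `‖E[e^Φ] − 1 − E[Φ]‖ ≤ s²` for measurable `Φ` with `‖Φ‖ ≤ s ≤ 1`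
(pointwise `‖e^z − 1 − z‖ ≤ ‖z‖²`, `Complex.norm_exp_sub_one_sub_id_le`). [folklore] -/
theorem norm_integral_cexp_sub_one_sub_le {Φ : Ω → ℂ} (hΦ : Measurable Φ) {s : ℝ} (hs : ∀ x, ‖Φ x‖ ≤ s)
    (hs1 : s ≤ 1) : ‖(∫ x, Complex.exp (Φ x) ∂μ) - 1 - ∫ x, Φ x ∂μ‖ ≤ s ^ 2 := by
  have hI1 : Integrable (fun x => Complex.exp (Φ x)) μ := integrable_cexp_of_norm_le μ hΦ hs
  have hI2 : Integrable Φ μ := integrable_of_norm_le μ hΦ hs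
  have hI3 : Integrable (fun x => Complex.exp (Φ x) - 1) μ := hI1.sub (integrable_const _)
  have e1 : ∫ x, (Complex.exp (Φ x) - 1 - Φ x) ∂μ = (∫ x, (Complex.exp (Φ x) - 1) ∂μ) - ∫ x, Φ x ∂μ :=
    integral_sub hI3 hI2
  have e2 : ∫ x, (Complex.exp (Φ x) - 1) ∂μ = (∫ x, Complex.exp (Φ x) ∂μ) - ∫ _x, (1 : ℂ) ∂μ :=
    integral_sub hI1 (integrable_const _)
  have e3 : ∫ _x, (1 : ℂ) ∂μ = 1 := by rw [integral_const, probReal_univ, one_smul]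
  rw [← e3, ← e2, ← e1]
  have h := norm_integral_le_of_norm_le_const (μ := μ) (f := fun x => Complex.exp (Φ x) - 1 - Φ x) (C := s ^ 2)
    (ae_of_all μ fun x => (Complex.norm_exp_sub_one_sub_id_le ((hs x).trans hs1)).trans
      (pow_le_pow_left₀ (norm_nonneg _) (hs x) 2))
  rwa [probReal_univ, mul_one] at h

/-- **THE COMPLEX NETTED BIRTH IS SECOND ORDER**: for measurable `Φ : Ω → ℂ` with `‖Φ‖ ≤ s ≤ 1/4`,
`‖log E[e^Φ] − E[Φ]‖ ≤ 3 s²` (principal logarithm; `E[e^Φ]` lies within `s + s² ≤ 5/16` of `1`).  The complex analogue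
of `log_integral_exp_le` / `integral_le_log_integral_exp`; constants not optimised. [folklore] -/
theorem norm_log_integral_cexp_sub_le {Φ : Ω → ℂ} (hΦ : Measurable Φ) {s : ℝ} (hs : ∀ x, ‖Φ x‖ ≤ s)
    (hs0 : 0 ≤ s) (hs4 : s ≤ 1 / 4) :
    ‖Complex.log (∫ x, Complex.exp (Φ x) ∂μ) - ∫ x, Φ x ∂μ‖ ≤ 3 * s ^ 2 := by
  set w : ℂ := ∫ x, Complex.exp (Φ x) ∂μ with hw
  set m : ℂ := ∫ x, Φ x ∂μ with hm
  have h1 : ‖w - 1 - m‖ ≤ s ^ 2 := norm_integral_cexp_sub_one_sub_le μ hΦ hs (by linarith)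
  have hmle : ‖m‖ ≤ s := norm_integral_le_of_norm_le_prob μ hs
  have hz : ‖w - 1‖ ≤ s + s ^ 2 := by
    have : w - 1 = (w - 1 - m) + m := by ring
    rw [this]
    exact (norm_add_le _ _).trans (by linarith)
  have hsq : (s + s ^ 2) ^ 2 ≤ 25 / 16 * s ^ 2 := by
    have h1s : (1 + s) ^ 2 ≤ 25 / 16 := by nlinarith
    calc (s + s ^ 2) ^ 2 = s ^ 2 * (1 + s) ^ 2 := by ring
      _ ≤ s ^ 2 * (25 / 16) := mul_le_mul_of_nonneg_left h1s (sq_nonneg s)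
      _ = 25 / 16 * s ^ 2 := by ring
  have hz' : ‖w - 1‖ ≤ 5 / 16 := by nlinarith
  have hzlt : ‖w - 1‖ < 1 := by linarith
  have hinv : (1 - ‖w - 1‖)⁻¹ ≤ 16 / 11 := by
    rw [inv_le_comm₀ (by linarith) (by norm_num)]
    linarith
  have hlog : ‖Complex.log (1 + (w - 1)) - (w - 1)‖ ≤ (s + s ^ 2) ^ 2 * (16 / 11) / 2 :=
    (Complex.norm_log_one_add_sub_self_le hzlt).trans (by gcongr)
  rw [add_sub_cancel] at hlog
  calc ‖Complex.log w - m‖ = ‖(Complex.log w - (w - 1)) + (w - 1 - m)‖ := by ring_nf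
    _ ≤ ‖Complex.log w - (w - 1)‖ + ‖w - 1 - m‖ := norm_add_le _ _
    _ ≤ (s + s ^ 2) ^ 2 * (16 / 11) / 2 + s ^ 2 := add_le_add hlog h1
    _ ≤ 3 * s ^ 2 := by nlinarith

/-- **BUDGETS ADD AND ARE RE-ATTRIBUTED, complex fibre**: `Φ = ω + Σ_{i∈I} Δ_i` with `‖ω‖ ≤ s_ω`, `‖Δ_i‖ ≤ S_i`,
`s_ω + Σ S_i ≤ 1/4` ⇒ `‖log E[e^Φ] − Σ_i E[Δ_i]‖ ≤ s_ω + 3 (s_ω + Σ S_i)²`.  The complex analogue of `netted_birth_le`: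
the NETTED absorption constant on a complex fibre is `3·sup‖Φ‖` — still SMALL. [folklore] -/
theorem netted_birth_le_complex {ι : Type*} (I : Finset ι) {ω : Ω → ℂ} {Δ : ι → Ω → ℂ} (hω : Measurable ω)
    (hΔ : ∀ i ∈ I, Measurable (Δ i)) {sω : ℝ} {S : ι → ℝ} (hsω : ∀ x, ‖ω x‖ ≤ sω)
    (hS : ∀ i ∈ I, ∀ x, ‖Δ i x‖ ≤ S i) (h4 : sω + ∑ i ∈ I, S i ≤ 1 / 4) :
    ‖Complex.log (∫ x, Complex.exp (ω x + ∑ i ∈ I, Δ i x) ∂μ) - ∑ i ∈ I, ∫ x, Δ i x ∂μ‖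
      ≤ sω + 3 * (sω + ∑ i ∈ I, S i) ^ 2 := by
  have hΦm : Measurable fun x => ω x + ∑ i ∈ I, Δ i x := hω.add (Finset.measurable_sum I hΔ)
  have hΦb : ∀ x, ‖ω x + ∑ i ∈ I, Δ i x‖ ≤ sω + ∑ i ∈ I, S i := fun x =>
    (norm_add_le _ _).trans (add_le_add (hsω x)
      ((norm_sum_le _ _).trans (Finset.sum_le_sum fun i hi => hS i hi x)))
  have hne : Nonempty Ω := by
    by_contra h
    rw [not_nonempty_iff] at h
    have := IsProbabilityMeasure.measure_univ (μ := μ)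
    rw [Set.univ_eq_empty_iff.mpr h, measure_empty] at this
    exact zero_ne_one this
  have hs0 : 0 ≤ sω + ∑ i ∈ I, S i := (norm_nonneg _).trans (hΦb hne.some)
  have hmain := norm_log_integral_cexp_sub_le μ hΦm hΦb hs0 h4
  have hiω : Integrable ω μ := integrable_of_norm_le μ hω hsω
  have hiΔ : ∀ i ∈ I, Integrable (Δ i) μ := fun i hi => integrable_of_norm_le μ (hΔ i hi) (hS i hi)
  have hisum : Integrable (fun x => ∑ i ∈ I, Δ i x) μ := integrable_finsetSum I hiΔ
  have hA : ∫ x, (ω x + ∑ i ∈ I, Δ i x) ∂μ = ∫ x, ω x ∂μ + ∫ x, (∑ i ∈ I, Δ i x) ∂μ := integral_add hiω hisum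
  have hB : ∫ x, (∑ i ∈ I, Δ i x) ∂μ = ∑ i ∈ I, ∫ x, Δ i x ∂μ := integral_finsetSum I hiΔ
  have hωI : ‖∫ x, ω x ∂μ‖ ≤ sω := norm_integral_le_of_norm_le_prob μ hsω
  rw [hA, hB] at hmain
  set L := Complex.log (∫ x, Complex.exp (ω x + ∑ i ∈ I, Δ i x) ∂μ)
  set a := ∫ x, ω x ∂μ
  set b := ∑ i ∈ I, ∫ x, Δ i x ∂μ
  calc ‖L - b‖ = ‖(L - (a + b)) + a‖ := by ring_nf
    _ ≤ ‖L - (a + b)‖ + ‖a‖ := norm_add_le _ _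
    _ ≤ 3 * (sω + ∑ i ∈ I, S i) ^ 2 + sω := add_le_add hmain hωI
    _ = sω + 3 * (sω + ∑ i ∈ I, S i) ^ 2 := by ring

/-- **(1.74) IN THE ABSTRACTION** — the normalisation stays away from zero: `‖Φ‖ ≤ s ≤ 1/4` ⇒
`e^{−2s} ≤ 1 − s − s² ≤ ‖E[e^Φ]‖` (so the principal logarithm above is taken in the disc `‖w − 1‖ ≤ 5/16`).  Printed:
*"|T′_k(X,(U,J))1| = |T′_k(X,(U,0))e^σ| ≥ T′_k(X,(U,0))e^{−2|σ|}"* (1.74) p. 380 — there via `Re e^σ ≥ e^{−2|σ|}`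
(kernel for finite positive functionals: `B16.ineq174`); here the cruder second-order route, constants as printed. [folklore] -/
theorem exp_neg_two_mul_le_norm_integral_cexp {Φ : Ω → ℂ} (hΦ : Measurable Φ) {s : ℝ} (hs : ∀ x, ‖Φ x‖ ≤ s)
    (hs0 : 0 ≤ s) (hs4 : s ≤ 1 / 4) : Real.exp (-2 * s) ≤ ‖∫ x, Complex.exp (Φ x) ∂μ‖ := by
  set w : ℂ := ∫ x, Complex.exp (Φ x) ∂μ with hw
  set m : ℂ := ∫ x, Φ x ∂μ with hm
  have h1 : ‖w - 1 - m‖ ≤ s ^ 2 := norm_integral_cexp_sub_one_sub_le μ hΦ hs (by linarith)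
  have hmle : ‖m‖ ≤ s := norm_integral_le_of_norm_le_prob μ hs
  have hz : ‖w - 1‖ ≤ s + s ^ 2 := by
    have : w - 1 = (w - 1 - m) + m := by ring
    rw [this]
    exact (norm_add_le _ _).trans (by linarith)
  have hlow : 1 - s - s ^ 2 ≤ ‖w‖ := by
    have h := norm_add_le w (1 - w)
    rw [add_sub_cancel, norm_one, norm_sub_rev] at h
    linarith
  have hexp : Real.exp (-2 * s) ≤ (1 + 2 * s)⁻¹ := by
    have h := Real.add_one_le_exp (2 * s)
    rw [show -2 * s = -(2 * s) by ring, Real.exp_neg]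
    exact inv_anti₀ (by linarith) (by linarith)
  have hrat : (1 + 2 * s)⁻¹ ≤ 1 - s - s ^ 2 := by
    rw [inv_eq_one_div, div_le_iff₀ (by linarith)]
    nlinarith
  exact hexp.trans (hrat.trans hlow)

/-- **(1.75) IN THE ABSTRACTION — SIZES MULTIPLY with `a = e^{3 sup‖Φ‖}` on a complex fibre**: for measurable `Φ` with
`‖Φ‖ ≤ s ≤ 1/4` and an a.e.-bounded factor `‖F‖ ≤ f`, `‖E[e^Φ F]‖ ≤ e^{3s}·f·‖E[e^Φ]‖`, i.e. the NORMALISED continuation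
`E[e^Φ F]/E[e^Φ]` has size `≤ e^{3s} f`.  Printed: *"|(T′_k(X,(U,J))1)^{−1} T′_k(X,(U,J))F| ≤ e^{3 sup|σ|} sup|F|. (1.75)"*
p. 380 (kernel for finite positive functionals: `B16.ineq175`).  The `Continues a` shape of §2 with `a k = e^{3 s_k}`. [folklore] -/
theorem norm_integral_cexp_mul_le {Φ F : Ω → ℂ} (hΦ : Measurable Φ) {s f : ℝ}
    (hs : ∀ x, ‖Φ x‖ ≤ s) (hs0 : 0 ≤ s) (hs4 : s ≤ 1 / 4) (hf : ∀ x, ‖F x‖ ≤ f) (hf0 : 0 ≤ f) :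
    ‖∫ x, Complex.exp (Φ x) * F x ∂μ‖ ≤ Real.exp (3 * s) * f * ‖∫ x, Complex.exp (Φ x) ∂μ‖ := by
  have hnum : ‖∫ x, Complex.exp (Φ x) * F x ∂μ‖ ≤ Real.exp s * f := by
    have h := norm_integral_le_of_norm_le_const (μ := μ) (f := fun x => Complex.exp (Φ x) * F x)
      (C := Real.exp s * f) (ae_of_all μ fun x => by
        rw [norm_mul, Complex.norm_exp]
        exact mul_le_mul (Real.exp_le_exp.2 ((Complex.re_le_norm _).trans (hs x))) (hf x) (norm_nonneg _)
          (Real.exp_pos _).le)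
    rwa [probReal_univ, mul_one] at h
  have hden : Real.exp (-2 * s) ≤ ‖∫ x, Complex.exp (Φ x) ∂μ‖ :=
    exp_neg_two_mul_le_norm_integral_cexp μ hΦ hs hs0 hs4
  have h3 : Real.exp s = Real.exp (3 * s) * Real.exp (-2 * s) := by
    rw [← Real.exp_add]; ring_nf
  calc ‖∫ x, Complex.exp (Φ x) * F x ∂μ‖ ≤ Real.exp s * f := hnum
    _ = Real.exp (3 * s) * f * Real.exp (-2 * s) := by rw [h3]; ring
    _ ≤ Real.exp (3 * s) * f * ‖∫ x, Complex.exp (Φ x) ∂μ‖ :=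
        mul_le_mul_of_nonneg_left hden (mul_nonneg (Real.exp_pos _).le hf0)

end ComplexNetted

end Literature.MathematicalPhysics.QuantumFieldTheory.Balaban1983to89.T4PreservedUnderR
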